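import Summits.QuantumAdvantage.AdviceFreeQNC0.SparseRead39B
import Summits.QuantumAdvantage.AdviceFreeQNC0.Pinned39C
import HarnessLib

/-!
# Cell qa-qnc0, `p = 3` — ROUND-38 §6.4.3: **(R1)₀ UNCONDITIONAL** — `SparseRead39.R1Zero ρ` for some `ρ < 1`

Planner qa-qnc0-p1 g39 (P1-39b, 2026-08-29 21:39Z): "A39-7 PROVED ⇒ (R1)₀ unconditional (modulo port)".  The two halves are now
tree files (ports by qn-prover-3 g24): `BondTwist3.twistBoundZConstPinned` (`Pinned39C.lean`: the constant-output twist bound on pinned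
subcubes, `∃ ρ < 1`, via the `r = 0` register chain in which a pinned letter is a bijective, exactly-`½`-in-`ℓ²` step) and
`SparseRead39.r1Zero_of_pinned` (`SparseRead39B.lean`: the lossless pinned reduction).  `BondTwist3.TwistBoundZConstPinned` is the
custody file's VERBATIM unfolding of `SparseRead39.TwistBoundZConstPinned` (HOME files could not import each other); the two agree
definitionally (`twistBoundZConstPinned_iff`), whence:

* **`SparseRead39.r1Zero`** — `∃ ρ, 0 ≤ ρ ∧ ρ < 1 ∧ R1Zero ρ`: every strategy measurable with respect to the letters of an ARBITRARY set
  `W` obeys `‖Σ_x e₃(β·x)·[OddZeros x ∧ Rel x (g x)]‖ ≤ A·ρ^{#{i ∉ W : β_i ≠ 0}}·2^N` (the `T_k ⊆ W` case of (R1), all `C`; p2's A38P2-1′: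
  confined strategies for ANY `|U|`).

WHAT THIS IS NOT: (R1) for scattered juntas beyond the measurable case (`C ≥ 0` with genuine sparse reads) stays open (P1-39b: next case
`C = 0` = `TwistBoundZAffinePinned`); crux 22907 untouched; no separation claim.
-/

noncomputable section

namespace Summit.QuantumAdvantage.AdviceFreeQNC0

open Finset

/-- The custody file's unfolded restatement agrees with `SparseRead39.TwistBoundZConstPinned` (definitionally). -/
theorem twistBoundZConstPinned_iff (ρ : ℝ) :
    BondTwist3.TwistBoundZConstPinned ρ ↔ SparseRead39.TwistBoundZConstPinned ρ := Iff.rfl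

/-- **(R1)₀ — PROVED (planner p1 g39's Theorem, ROUND-38 §6.4.3 / P1-39b; tree assembly).** -/
theorem SparseRead39.r1Zero : ∃ ρ : ℝ, 0 ≤ ρ ∧ ρ < 1 ∧ SparseRead39.R1Zero ρ := by
  obtain ⟨ρ, h0, h1, h⟩ := BondTwist3.twistBoundZConstPinned
  exact ⟨ρ, h0, h1, SparseRead39.r1Zero_of_pinned ((twistBoundZConstPinned_iff ρ).1 h)⟩

end Summit.QuantumAdvantage.AdviceFreeQNC0

end
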